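import Mathlib
import HarnessLib
import Summits.AtomisticToContinuum.FouriersLaw.Theses.JunctionLocality
import Summits.AtomisticToContinuum.FouriersLaw.Theorems.JunctionLocalityConductanceLowerBoundStubKuboLinkAux2

/-!
# Kubo link of line `ForecastSensitivitySketch`, helper V: regularity and growth of EVERY classical forward
field (stub `stub_kuboLink`, crux stmt-AtomisticToContinuum-11749; `g`-side inputs of the mixing-free route)

For the pinned anharmonic chain `pinnedChain ω₂ lam β γ` (all parameters `> 0`), `T > 0`, `L ≥ 1`, and EVERY
classical forward field `g` of the left bath (`C² ∩ L²(μ_T)`, mean zero, `L_{T,T} g = −(p_0² − T)` pointwise):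

* `forwardField_contDiff` — `g` is smooth, and `forwardField_abs_le_exp` — `|g| ≤ M e^{H/(4T)}` EVERYWHERE
  (uniqueness of classical forward fields, `plainForwardField_unique'`, identifies `g` with the Hörmander-smooth
  representative of the semigroup Poisson field `∫₀^∞ P_t k_0 dt` of helper II, whose weighted sup bound
  `abs_poissonField_le` transfers from Lebesgue-a.e. to everywhere by continuity:
  `le_of_ae_le_of_continuous`);
* `memLp_two_of_abs_le_exp` — continuous `|f| ≤ C e^{ϑH}` with `2ϑ < 1/T` is in `L²(μ_T)`.

These are the `g`-side inputs of the mixing-free Kubo link (helper VI). References: CEHR 2018, Thm 2.13;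
Hörmander 1967, Thm 1.1; folklore.
-/

noncomputable section

open MeasureTheory Filter Topology Set ProbabilityTheory
open scoped ContDiff NNReal ENNReal
open Literature.MathematicalPhysics.KineticTheory.HeatConduction
open Literature.MathematicalPhysics.KineticTheory Literature.Probability.Process OscillatorChain
open Summit.AtomisticToContinuum.FouriersLaw.Theorems
open Summit.AtomisticToContinuum.FouriersLaw.Theorems.SubdiffusiveBondHeat
open Summit.AtomisticToContinuum.FouriersLaw.Theorems.SuperadditiveResistance.DeviceLiouville (kin kin_eq_sq)
open Summit.AtomisticToContinuum.FouriersLaw.Cruxes.SuperadditiveResistance.FloatingProbeBypassLaplacian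

namespace Summit.AtomisticToContinuum.FouriersLaw.Cruxes.ConductanceLowerBound.ForecastSensitivity

/-! ## From a.e. to everywhere; exponential bounds and `L²(μ_T)` -/

/-- An a.e. (Lebesgue) inequality between continuous functions on phase space holds everywhere (Lebesgue
measure charges nonempty open sets). [folklore] -/
theorem le_of_ae_le_of_continuous {L : ℕ} {f B : PhaseSpace L → ℝ} (hf : Continuous f) (hB : Continuous B)
    (h : ∀ᵐ x ∂(volume : Measure (PhaseSpace L)), f x ≤ B x) (x : PhaseSpace L) : f x ≤ B x := by
  haveI := isAddHaarMeasure_volume_phaseSpace L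
  by_contra hx
  have hopen : IsOpen {y : PhaseSpace L | B y < f y} := isOpen_lt hB hf
  have hpos : 0 < (volume : Measure (PhaseSpace L)) {y : PhaseSpace L | B y < f y} :=
    hopen.measure_pos volume ⟨x, not_le.1 hx⟩
  have hzero : (volume : Measure (PhaseSpace L)) {y : PhaseSpace L | B y < f y} = 0 := by
    rw [ae_iff] at h
    simpa only [not_le] using h
  exact hpos.ne' hzero

/-- A continuous `e^{ϑH}`-dominated observable is in `L²(μ_T)` when `2ϑ < 1/T` (pinned chain, `T > 0`). [folklore] -/
theorem memLp_two_of_abs_le_exp {ω₂ lam β : ℝ} (hω : 0 < ω₂) (hl : 0 ≤ lam) (hβ : 0 ≤ β) (γ : ℝ) (L : ℕ)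
    {T : ℝ} (hT : 0 < T) {ϑ C : ℝ} (h2ϑ : 2 * ϑ < 1 / T) {f : PhaseSpace L → ℝ} (hf : Continuous f)
    (hfb : ∀ x, |f x| ≤ C * Real.exp (ϑ * (pinnedChain ω₂ lam β γ).hamiltonian L x)) :
    MemLp f 2 ((pinnedChain ω₂ lam β γ).gibbsMeasure L T) := by
  -- adapted from `memLp_poissonField` (…StubPlainKuboLinkAux2)
  set w : PhaseSpace L → ℝ := fun z => C * Real.exp (ϑ * (pinnedChain ω₂ lam β γ).hamiltonian L z) with hw
  have hwc : Continuous w := continuous_const.mul (Real.continuous_exp.comp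
    (continuous_const.mul (pinnedChain_continuous_hamiltonian ω₂ lam β γ L)))
  have hw2 : MemLp w 2 ((pinnedChain ω₂ lam β γ).gibbsMeasure L T) := by
    refine (memLp_two_iff_integrable_sq hwc.aestronglyMeasurable).2 ?_
    have h2 := pinnedChain_integrable_exp_mul_hamiltonian_gibbsMeasure hω hl hβ γ L hT h2ϑ
    refine (h2.const_mul (C ^ 2)).congr (Eventually.of_forall fun z => ?_)
    simp only [hw]
    rw [mul_pow, sq (Real.exp _), ← Real.exp_add]
    ring_nf
  refine hw2.mono' hf.aestronglyMeasurable (Eventually.of_forall fun z => ?_)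
  rw [Real.norm_eq_abs]
  exact hfb z

/-! ## Every classical forward field is smooth and `e^{H/4T}`-bounded -/

section ForwardField

variable {ω₂ lam β γ : ℝ} (hω : 0 < ω₂) (hl : 0 ≤ lam) (hβ : 0 < β) (hγ : 0 < γ) {L : ℕ} (hL : 0 < L)
  {T : ℝ} (hT : 0 < T) {g : PhaseSpace L → ℝ} (hC : ContDiff ℝ 2 g)
  (hL2 : MemLp g 2 ((pinnedChain ω₂ lam β γ).gibbsMeasure L T))
  (hmean : ∫ x, g x ∂((pinnedChain ω₂ lam β γ).gibbsMeasure L T) = 0)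
  (hpde : ∀ x, (pinnedChain ω₂ lam β γ).generator L T T g x = -(kin L 0 x - T))
include hω hl hβ hγ hL hT hC hL2 hmean hpde

/-- **Every classical forward field of the left bath is smooth** (it IS the Hörmander-smooth semigroup field,
by `plainForwardField_unique'`). -/
theorem forwardField_contDiff : ContDiff ℝ ((⊤ : ℕ∞) : WithTop ℕ∞) g := by
  obtain ⟨g', hg's, hL2', hmean', hpde', -⟩ := exists_forwardField_ae_eq_poissonField hω hl hβ hγ hL hT
  have hpde'' : ∀ x, (pinnedChain ω₂ lam β γ).generator L T T g' x = -(kin L 0 x - T) := fun x => by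
    rw [hpde' x, kin_eq_sq hL]
  have heq : g = g' := plainForwardField_unique' hω hl hβ.le hγ hL hT 0 hC hL2 hmean hpde
    (hg's.of_le (by norm_cast)) hL2' hmean' hpde''
  rw [heq]; exact hg's

/-- **Every classical forward field is `e^{H/4T}`-bounded EVERYWHERE**: `∃ M ≥ 0, |g x| ≤ M e^{H(x)/(4T)}` for all
`x` (the weighted sup bound `abs_poissonField_le` of the semigroup Poisson field `∫₀^∞ P_t k_0 dt`, transferred along
the Lebesgue-a.e. identification `forwardField_ae_eq_poissonField` to the continuous `g`). -/
theorem forwardField_abs_le_exp :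
    ∃ M : ℝ, 0 ≤ M ∧ ∀ x, |g x| ≤ M * Real.exp (1 / (4 * T) * (pinnedChain ω₂ lam β γ).hamiltonian L x) := by
  set ϑ₀ : ℝ := 1 / (4 * T) with hϑ₀
  have hϑ₀0 : 0 < ϑ₀ := by positivity
  have hϑ₀1 : ϑ₀ < 1 / T := by rw [hϑ₀, div_lt_div_iff₀ (by positivity) hT]; nlinarith
  set k : PhaseSpace L → ℝ := fun y => y.2 ⟨0, hL⟩ ^ 2 - T with hk
  have hkc : Continuous k := by rw [hk]; fun_prop
  have hkb0 : ∀ y, |k y| ≤ (2 / ϑ₀ + T) * Real.exp (ϑ₀ * (pinnedChain ω₂ lam β γ).hamiltonian L y) := fun y =>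
    abs_sq_momentum_sub_le_exp hω hl hβ.le hϑ₀0 hT.le y ⟨0, hL⟩
  obtain ⟨Cp, hCp, hGb⟩ := abs_poissonField_le hω hl hβ hγ hL hT hϑ₀0 hϑ₀1
  have hae : poissonField ω₂ lam β γ T L k =ᵐ[volume] g :=
    forwardField_ae_eq_poissonField hω hl hβ hγ hL hT hC hL2 hmean hpde
  refine ⟨(2 / ϑ₀ + T) * Cp, by positivity, ?_⟩
  have hG : ∀ x, |poissonField ω₂ lam β γ T L k x| ≤
      (2 / ϑ₀ + T) * Cp * Real.exp (ϑ₀ * (pinnedChain ω₂ lam β γ).hamiltonian L x) := fun x =>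
    hGb (2 / ϑ₀ + T) (by positivity) k hkc hkb0 x
  have haeb : ∀ᵐ x ∂(volume : Measure (PhaseSpace L)),
      |g x| ≤ (2 / ϑ₀ + T) * Cp * Real.exp (ϑ₀ * (pinnedChain ω₂ lam β γ).hamiltonian L x) := by
    filter_upwards [hae] with x hx
    rw [← hx]; exact hG x
  have hHc := pinnedChain_continuous_hamiltonian ω₂ lam β γ L
  exact le_of_ae_le_of_continuous (f := fun x => |g x|)
    (B := fun x => (2 / ϑ₀ + T) * Cp * Real.exp (ϑ₀ * (pinnedChain ω₂ lam β γ).hamiltonian L x))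
    (continuous_abs.comp hC.continuous) (by fun_prop) haeb

end ForwardField

/-! ## Registered sub-goal -/

/-- **Registered sub-goal `helper_kuboForwardFieldGrowth`** (wave-2 helper V of stub `stub_kuboLink`, crux
stmt-AtomisticToContinuum-11749): every classical forward field of the left bath is smooth and `e^{H/4T}`-bounded
everywhere (`forwardField_contDiff`, `forwardField_abs_le_exp`). -/
theorem helper_kuboForwardFieldGrowth :
    ∀ {ω₂ lam β γ : ℝ}, 0 < ω₂ → 0 ≤ lam → 0 < β → 0 < γ → ∀ {L : ℕ} (hL : 0 < L) {T : ℝ}, 0 < T → ∀ {g : PhaseSpace L → ℝ}, ContDiff ℝ 2 g → MemLp g 2 ((pinnedChain ω₂ lam β γ).gibbsMeasure L T) → ∫ x, g x ∂((pinnedChain ω₂ lam β γ).gibbsMeasure L T) = 0 → (∀ x, (pinnedChain ω₂ lam β γ).generator L T T g x = -(kin L 0 x - T)) → ContDiff ℝ ((⊤ : ℕ∞) : WithTop ℕ∞) g ∧ ∃ M : ℝ, 0 ≤ M ∧ ∀ x, |g x| ≤ M * Real.exp (1 / (4 * T) * (pinnedChain ω₂ lam β γ).hamiltonian L x) := by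
  intro ω₂ lam β γ hω hl hβ hγ L hL T hT g hC hL2 hmean hpde
  exact ⟨forwardField_contDiff hω hl hβ hγ hL hT hC hL2 hmean hpde,
    forwardField_abs_le_exp hω hl hβ hγ hL hT hC hL2 hmean hpde⟩

end Summit.AtomisticToContinuum.FouriersLaw.Cruxes.ConductanceLowerBound.ForecastSensitivity

end
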